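import Mathlib
import HarnessLib
import Summits.NavierStokesRegularity.NavierStokesRegularity.Theorems.TypeIQuarterGateScarEnvelopeTypeIForcedTsaiAlgSound
import Summits.NavierStokesRegularity.NavierStokesRegularity.Theorems.TypeIQuarterGateScarEnvelopeTypeIForcedTsaiAlgWitnessML16
import Summits.NavierStokesRegularity.NavierStokesRegularity.Theorems.TypeIQuarterGateScarEnvelopeTypeIForcedTsaiAlgWitnessML8
import Summits.NavierStokesRegularity.NavierStokesRegularity.Theorems.TypeIQuarterGateScarEnvelopeTypeIForcedTsaiAlgWitnessML4

/-!
# ARM B lane E-exact — multi-ℓ LANEX-ALG rows AS TREE THEOREMS: `ForcedTsaiModulusLE 16 323.28`, `8 149.685`, `4 69.073`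

Closers of the kernel-checked multi-ℓ Type-I-tail witness rows `algRowML16/ML8/ML4` (poloidal ℓ ≤ 4 + toroidal (swirl)
ℓ ≤ 4 modes × algebraic radial powers, τ = 3, exact far-field closure) through `AlgRow.sound` (`…AlgSound`):
certified UPPER bounds on the forced-Tsai modulus in the tree currency (`ℝ³`, weight `(1+ρ)⁵`, level on `B₁₀`):
`δ*(16) ≤ 323.28` (δ/M = 20.21), `δ*(8) ≤ 149.685` (18.71), `δ*(4) ≤ 69.073` (17.27) — vs the Gaussian-class tree rows
`…_16_642` (40.1) and the single-ℓ Type-I rows of `…AlgWitnessL1T3Sound` (19.92 @4).  Experiment-cell context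
(ns-wall-extremal ARM B): the engines' float optimum in the truncated class is ≈ 17.4–17.6 @16 and the best
interval-certified Type-I witness on `B₄₀` is 17.50 @16 (eng-3); this row is the tree-currency KERNEL statement.
«Near-profiles this good EXIST»; UPPER bounds only; excludes nothing; nothing about NS regularity; 23843 / H3 OPEN.
-/

set_option linter.dupNamespace false

namespace Summit.NavierStokesRegularity.NavierStokesRegularity.Cruxes.ScarEnvelopeTypeI.ForcedTsai

/-- `δ*(16) ≤ 8082/25 = 323.28` in the Type-I-tail class (δ/M = 20.21): near-profiles of level 16 with weighted
vorticity residual ≤ 323.28 exist. -/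
theorem forcedTsaiModulusLE_algML_16 : ForcedTsaiModulusLE (16 : ℝ) (8082 / 25 : ℝ) := by
  have h := algRowML16.sound algRowML16_check
  norm_num [algRowML16] at h
  exact h

/-- `δ*(8) ≤ 29937/200 = 149.685` (δ/M = 18.71). -/
theorem forcedTsaiModulusLE_algML_8 : ForcedTsaiModulusLE (8 : ℝ) (29937 / 200 : ℝ) := by
  have h := algRowML8.sound algRowML8_check
  norm_num [algRowML8] at h
  exact h

/-- `δ*(4) ≤ 69073/1000 = 69.073` (δ/M = 17.27). -/
theorem forcedTsaiModulusLE_algML_4 : ForcedTsaiModulusLE (4 : ℝ) (69073 / 1000 : ℝ) := by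
  have h := algRowML4.sound algRowML4_check
  norm_num [algRowML4] at h
  exact h

/-- Rounded: `ForcedTsaiModulusLE 16 324` (`δ/M ≤ 20.25` at level 16, Type-I-tail class; cf. `…_16_642`, Gaussian class). -/
theorem forcedTsaiModulusLE_16_324 : ForcedTsaiModulusLE (16 : ℝ) (324 : ℝ) :=
  forcedTsaiModulusLE_algML_16.mono le_rfl (by norm_num)

end Summit.NavierStokesRegularity.NavierStokesRegularity.Cruxes.ScarEnvelopeTypeI.ForcedTsai
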